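import Literature.NumberTheory.LFunctions.MatomakiRadziwillTaoT2OfVK
import Literature.NumberTheory.LFunctions.VinogradovZetaSum
import Literature.NumberTheory.LFunctions.VinogradovMeanValueTheorem
import HarnessLib

/-!
# parity.S21 — Tao's logarithmically averaged two-point Chowla theorem (Liouville form): the discharge

Topic `Literature/NumberTheory/Sieve`.  Everything in this file is PROVED; no definitions, no named facts.

T. Tao, *The logarithmically averaged Chowla and Elliott conjectures for two-point correlations*, Forum Math.
Pi 4 (2016), e8 (doi:10.1017/fmp.2016.6, arXiv:1509.05422), **Theorem 1.2** (with `ω(x) = x`) / Corollary 1.5: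
for natural numbers `a₁, a₂ ≥ 1` and `b₁, b₂ ≥ 0` with `a₁b₂ ≠ a₂b₁`,
`∑_{n ≤ x} λ(a₁n + b₁) λ(a₂n + b₂)/n = o(log x)` — the tree's named fact
`Literature.NumberTheory.Sieve.tao_log_chowla_liouville` (`ParityWave0.lean`, parity.S21).

`tao_log_chowla_liouville_holds` closes it.  The proof is the tree's formalisation of the printed proof:
* Tao 2016, §§2–5 — the reduction of Theorem 1.3 to Proposition 2.4 through the entropy decrement argument,
  Hoeffding, the circle method and the restriction theorem (`TaoLogElliott*.lean`, `TaoLogChowla*.lean`), and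
  Theorem 1.2 / Corollary 1.5 from Theorem 1.3 (`tao_log_chowla_liouville_of_prop24`);
* Matomäki–Radziwiłł–Tao 2015 — Proposition 2.4 ⇐ Theorem 1.7 ⇐ Theorem 2.3 ⇐ Proposition 2.4 ⇐ Theorem A.2 ⇐
  Proposition A.3 (`MatomakiRadziwillTao*.lean`), the latter from Matomäki–Radziwiłł 2016 §8 for complex `f`
  (`Sieve/MatomakiRadziwillProp1*.lean`, Lemma A.4 `MatomakiRadziwillTaoLemmaA4.lean`) and the restricted Halász
  theorem (`HalaszRestricted*.lean`), assembled for ANY Vinogradov–Korobov zero-free region in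
  `MRT2015.tao_log_chowla_liouville_of_vk` (`MatomakiRadziwillTaoT2OfVK.lean`);
* the Vinogradov–Korobov zero-free region for Dirichlet `L`-functions with an unspecified constant
  (`VinogradovZetaSum.hasVKZeroFreeRegion_of_vmvtBound`: Ivić's Theorem 6.2 for the shifted zeta sums, Ford's
  Richert-type bounds and Lemma 7.3) from Vinogradov's mean value theorem (`vmvtBound_thirtyTwo`, Ivić's
  Lemma 6.3, `VinogradovMeanValueTheorem.lean`).
`#print axioms` of the result: `propext`, `Classical.choice`, `Quot.sound`.

## References
* T. Tao, Forum Math. Pi 4 (2016), e8, doi:10.1017/fmp.2016.6, arXiv:1509.05422, Theorem 1.2 and Corollary 1.5.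
  [cite: TaoFMP2016, Theorem 1.2 and Corollary 1.5]
* K. Matomäki, M. Radziwiłł, T. Tao, *An averaged form of Chowla's conjecture*, Algebra & Number Theory 9 (2015),
  Theorem 1.7 and Appendix A. [cite: MatomakiRadziwillTao2015, Theorem 1.7]
* K. Matomäki, M. Radziwiłł, Ann. of Math. (2) 183 (2016), Proposition 1. [cite: MatomakiRadziwillAnnals2016, Proposition 1]
* A. Ivić, *The Riemann Zeta-Function* (1985), Theorem 6.2 and Lemma 6.3. [cite: Ivic1985, Theorem 6.2]
-/

namespace Literature.NumberTheory.Sieve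

open Literature.NumberTheory.LFunctions

/-- **Tao 2016, Theorem 1.2 / Corollary 1.5 (Liouville, `ω(x) = x`)** — the discharge of the named fact
`tao_log_chowla_liouville` (parity.S21): for `a₁, a₂ ≥ 1` and `a₁b₂ ≠ a₂b₁`,
`∑_{n ≤ x} λ(a₁n+b₁)λ(a₂n+b₂)/n = o(log x)`.  From the unconditional Vinogradov–Korobov region
(`VinogradovZetaSum.hasVKZeroFreeRegion_of_vmvtBound` with `vmvtBound_thirtyTwo`) and
`MRT2015.tao_log_chowla_liouville_of_vk`. [cite: TaoFMP2016, Theorem 1.2 and Corollary 1.5] -/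
theorem tao_log_chowla_liouville_holds : tao_log_chowla_liouville := by
  obtain ⟨c, hc, hVK⟩ := VinogradovZetaSum.hasVKZeroFreeRegion_of_vmvtBound (A := 32) (by norm_num) vmvtBound_thirtyTwo
  exact MRT2015.tao_log_chowla_liouville_of_vk hc hVK

end Literature.NumberTheory.Sieve
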